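import Literature.MathematicalPhysics.QuantumFieldTheory.ConformalBootstrap3D.PointKernelK34L505Data
import Literature.MathematicalPhysics.QuantumFieldTheory.ConformalBootstrap3D.PointKernelK34L505Segs
import Literature.MathematicalPhysics.QuantumFieldTheory.ConformalBootstrap3D.PointKernelParts

/-!
# K34L505 certificate, kernel part file P35: one-cell head segments 101 in level ranges

The head cells whose kernel evaluation exceeds one `decide` are one-cell segments of `hsegsK34L505`; each is
checked by `PCert.hPartSideOK` (side conditions) and `PCert.hPartOK` per level range `[n_lo, n_lo + count)`
against an integer claim, the claims summing to `≥ 0` (`PointKernel.partsOK`); soundness is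
`PCert.hParts_sound` (`PointKernelParts`).  The part files are mutually independent (each imports only
the data file); the ranges of one cell may span several of them, and the per-cell conclusions
`hparts_i` / `hcell_i` of those cells are assembled in `PointKernelK34L505.lean`.
Estimated kernel time 230 s.
-/

set_option maxRecDepth 100000
set_option maxHeartbeats 0

namespace Literature.MathematicalPhysics.QuantumFieldTheory.ConformalBootstrap3D.PointKernelK34L505

open Literature.MathematicalPhysics.QuantumFieldTheory.ConformalBootstrap3D.PointKernel

/-- levels `[28, 40)` of segment 101: partial lower sum `≥` claim. [folklore] -/
theorem part_101_1 : certK34L505.hPartOK (PCert.segAt hsegsK34L505 101) JHK34L505 28 12 (15661242051097553826603372074812159938) = true := by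
  decide +kernel

/-- levels `[40, 49)` of segment 101: partial lower sum `≥` claim. [folklore] -/
theorem part_101_2 : certK34L505.hPartOK (PCert.segAt hsegsK34L505 101) JHK34L505 40 9 (4261530201851260535078286374263375843) = true := by
  decide +kernel

/-- levels `[49, 56)` of segment 101: partial lower sum `≥` claim. [folklore] -/
theorem part_101_3 : certK34L505.hPartOK (PCert.segAt hsegsK34L505 101) JHK34L505 49 7 (1373632109146925645542138611502087637) = true := by
  decide +kernel

/-- levels `[56, 61)` of segment 101: partial lower sum `≥` claim. [folklore] -/
theorem part_101_4 : certK34L505.hPartOK (PCert.segAt hsegsK34L505 101) JHK34L505 56 5 (493076198110447284078849257532354234) = true := by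
  decide +kernel

end Literature.MathematicalPhysics.QuantumFieldTheory.ConformalBootstrap3D.PointKernelK34L505
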